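import Mathlib
import HarnessLib
import Summits.HubbardSuperconductivity.HubbardSuperconductivity.Theorems.KLProgrammeKLRegimeEnginePairTransferRelResAnalytic

/-!
# Route `KLProgramme` — ENGINE child gen 8 (stmt-HubbardSuperconductivity-20437 `KLRegimeEngineV17F2`), skeleton v2 class #5 rev 3, Ẽ-organisation (KLTC-INDEX §B′):
# the STEP from the analytic sizes, FLAT form — `pairTransferRelResIdx_family_succ_of_analytic_flat`
# (cell gate-hubbard-kl, seat hubbard-kl-k3c1-p1 g12, technique «composed-map remainder propagation»; companion of `…EnginePairTransferRelResAnalytic`)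

WHY.  `pairTransferRelResIdx_family_succ_of_analytic` (companion file) leaves the (c) closer ONE budget row per pair class: the four-term FT form of its analytic
majorant `Ran` against `θ·(2^{−(n+2)}·Tb(n,j′)(k,k′) + (3/5)·ROOM(n+1,j′)(k,k′))`.  When the analytic majorant is `k`-free (as the relative sources of a cutoff-built
pair are: D-line mass × kernel norms), the row is ONE NUMBER:
* §1 `kltc_fourTerm_le_of_le_const` — `FT_ρ(S)(k,k′) ≤ Rs·(1+σ)²` for `S ≤ Rs`, `(3m/2)·Σρᵢ ≤ σ`;
* §2 **`pairTransferRelResIdx_family_succ_of_analytic_flat`** — the STEP door with the budget row replaced by `∃ Rs, Ran ≤ Rs ∧ 2·Rs ≤ θ·ROOMfloor(n+1,j′)`,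
  `ROOMfloor(n+1,j′) = klIdxPrefactor r (n+1)·{(KlamU)²·[(2⁻ⁿ + 3/L)·klIdxMass n j′ + (4ⁿ⁺¹)⁻¹·klIdxOverlap (n+1) j′] + [(Klam|U|)³2⁻ⁿ + 3·thermalBar (n+1)]·klIdxMass n j′}`
  (the ROOM of `transferBarRelIdx_succ_room` without its two sector gains; the frame slack is given away; `(3mA/2)·Σρᵢ ≤ 1/32` ⇒ `FT_ρ(Ran) ≤ (33/32)²·Rs`).
Arithmetic over the companion door; the analytic SIZES stay hypotheses; nothing asserts (X).3, (c), K3 or superconductivity.  0 kit · 0 lit.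
-/

noncomputable section

namespace Summit.HubbardSuperconductivity.HubbardSuperconductivity.Theorems.KLRegimeSplit

set_option linter.dupNamespace false -- summit = problem name (single-conjunct summit), D-0017

open Finset Matrix Set Literature.MathematicalPhysics.QuantumLattice Literature.Probability.LatticeModels GrassmannAlgebra
open Literature.MathematicalPhysics.QuantumLattice.FermiRG
open Summit.HubbardSuperconductivity.HubbardSuperconductivity.Theorems.KLProgrammeCooperResummation
open Summit.HubbardSuperconductivity.HubbardSuperconductivity.Theorems.KLProgrammeLegKernels
open Summit.HubbardSuperconductivity.HubbardSuperconductivity.Theorems.DispersionFlow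
open Summit.HubbardSuperconductivity.HubbardSuperconductivity.Theorems.KLRegimeWick
open Summit.HubbardSuperconductivity.HubbardSuperconductivity.Theorems.EngineV8

/-! ## §1 The flat bound of the four-term FT form -/

section FourTerm

variable {ι : Type*} [Fintype ι]

/-- **Flat bound of the four-term FT form**: if `S ≤ Rs` pointwise and `(3m/2)·Σρ₁ ≤ σ`, `(3m/2)·Σρ₂ ≤ σ` (`ρᵢ ≥ 0`, `m ≥ 0`, `0 ≤ Rs`), then
`FT(S)(k,k′) ≤ Rs·(1 + σ)²`. -/
theorem kltc_fourTerm_le_of_le_const {m : ℝ} (hm : 0 ≤ m) {ρ₁ ρ₂ : ι → ℝ} (hρ₁ : ∀ a, 0 ≤ ρ₁ a) (hρ₂ : ∀ c, 0 ≤ ρ₂ c) {σ : ℝ}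
    (hσ₁ : 3 / 2 * m * ∑ a, ρ₁ a ≤ σ) (hσ₂ : 3 / 2 * m * ∑ c, ρ₂ c ≤ σ) (S : ι → ι → ℝ) {Rs : ℝ} (hRs : 0 ≤ Rs) (hS : ∀ x y, S x y ≤ Rs)
    (k k' : ι) :
    S k k' + ∑ c, S k c * ρ₂ c * (3 / 2 * m) + ∑ a, 3 / 2 * m * ρ₁ a * S a k' + ∑ a, ∑ c, 3 / 2 * m * ρ₁ a * S a c * ρ₂ c * (3 / 2 * m) ≤
      Rs * (1 + σ) ^ 2 := by
  have hm' : 0 ≤ 3 / 2 * m := by positivity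
  have hσ0 : 0 ≤ σ := le_trans (mul_nonneg hm' (Finset.sum_nonneg fun a _ => hρ₁ a)) hσ₁
  have t2 : ∑ c, S k c * ρ₂ c * (3 / 2 * m) ≤ Rs * σ := by
    calc ∑ c, S k c * ρ₂ c * (3 / 2 * m) ≤ ∑ c, Rs * ρ₂ c * (3 / 2 * m) :=
          Finset.sum_le_sum fun c _ => mul_le_mul_of_nonneg_right (mul_le_mul_of_nonneg_right (hS k c) (hρ₂ c)) hm'
      _ = Rs * (3 / 2 * m * ∑ c, ρ₂ c) := by rw [Finset.mul_sum, Finset.mul_sum]; exact Finset.sum_congr rfl fun c _ => by ring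
      _ ≤ Rs * σ := mul_le_mul_of_nonneg_left hσ₂ hRs
  have t3 : ∑ a, 3 / 2 * m * ρ₁ a * S a k' ≤ σ * Rs := by
    calc ∑ a, 3 / 2 * m * ρ₁ a * S a k' ≤ ∑ a, 3 / 2 * m * ρ₁ a * Rs :=
          Finset.sum_le_sum fun a _ => mul_le_mul_of_nonneg_left (hS a k') (mul_nonneg hm' (hρ₁ a))
      _ = (3 / 2 * m * ∑ a, ρ₁ a) * Rs := by rw [Finset.mul_sum, Finset.sum_mul]
      _ ≤ σ * Rs := mul_le_mul_of_nonneg_right hσ₁ hRs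
  have t4 : ∑ a, ∑ c, 3 / 2 * m * ρ₁ a * S a c * ρ₂ c * (3 / 2 * m) ≤ σ * Rs * σ := by
    calc ∑ a, ∑ c, 3 / 2 * m * ρ₁ a * S a c * ρ₂ c * (3 / 2 * m) ≤ ∑ a, ∑ c, 3 / 2 * m * ρ₁ a * Rs * ρ₂ c * (3 / 2 * m) :=
          Finset.sum_le_sum fun a _ => Finset.sum_le_sum fun c _ =>
            mul_le_mul_of_nonneg_right (mul_le_mul_of_nonneg_right (mul_le_mul_of_nonneg_left (hS a c) (mul_nonneg hm' (hρ₁ a))) (hρ₂ c)) hm'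
      _ = (3 / 2 * m * ∑ a, ρ₁ a) * Rs * (3 / 2 * m * ∑ c, ρ₂ c) := by
          rw [Finset.mul_sum, Finset.sum_mul, Finset.sum_mul, Finset.mul_sum]
          refine Finset.sum_congr rfl fun a _ => ?_
          rw [Finset.mul_sum]
          exact Finset.sum_congr rfl fun c _ => by ring
      _ ≤ σ * Rs * σ := by
          have hA : 0 ≤ 3 / 2 * m * ∑ a, ρ₁ a := mul_nonneg hm' (Finset.sum_nonneg fun a _ => hρ₁ a)
          have hC : 0 ≤ 3 / 2 * m * ∑ c, ρ₂ c := mul_nonneg hm' (Finset.sum_nonneg fun c _ => hρ₂ c)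
          exact mul_le_mul (mul_le_mul_of_nonneg_right hσ₁ hRs) hσ₂ hC (by positivity)
  nlinarith [hS k k']

end FourTerm

/-! ## §2 The flat STEP door -/

section Analytic

variable (L M : ℕ) [NeZero L] [NeZero M]

set_option maxHeartbeats 3200000 in -- very long hypothesis bundle; plumbing into `pairTransferRelResIdx_family_succ_of_analytic`
/-- **`pairTransferRelResIdx_family_succ_of_analytic_flat`** — `pairTransferRelResIdx_family_succ_of_analytic` with the budget row replaced by a `k`-free sup
`Ran ≤ Rs` and ONE number per pair class:
`2·Rs ≤ θ·klIdxPrefactor r (n+1)·{(KlamU)²·[(2⁻ⁿ + 3/L)·klIdxMass n j′ + (4ⁿ⁺¹)⁻¹·klIdxOverlap (n+1) j′] + [(Klam|U|)³2⁻ⁿ + 3·thermalBar (n+1)]·klIdxMass n j′}`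
(the two sector gains of the ROOM and the frame slack are given away; `(3mA/2)·Σρᵢ ≤ 1/32` makes `FT_ρ(Ran) ≤ (33/32)²·Rs`). -/
theorem pairTransferRelResIdx_family_succ_of_analytic_flat
    {R : RenConsts} {N : ℕ} {G : GeoConsts} (hCF : 0 ≤ G.CF) {P : SplitConsts} (hKl : 0 ≤ P.Klam) {r : ℝ} (hr : 0 ≤ r)
    {β U μ : ℝ} {n : ℕ} {mA θ : ℝ} (hm : 0 ≤ mA) (hθ0 : 0 ≤ θ)
    (hKf : FrameOK R U N μ (klFlowFrameU L M β U μ (n + 1))) (hβ : klBetaMin ≤ β) (hβL : β ≤ L) (hη₀ : Real.pi / (L : ℝ) ≤ klScale klE0 n)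
    (hnum : mA * ((2 : ℝ) ^ 10 * 15367) ≤ 1 / 3)
    (hZ : ∀ Λ ∈ Icc (klScale klE0 (n + 1)) (klScale klE0 n), hubbardEffPartitionFnCT L M β U μ 0 (klFlowFrameU L M β U μ (n + 1)) Λ ≠ 0)
    (A A' : ℕ → TorusSite 2 L → ℝ → Matrix (TorusSite 2 L) (TorusSite 2 L) ℂ) (b b' : ℕ → TorusSite 2 L → ℝ → TorusSite 2 L → ℂ)
    (a : ℕ → ℕ → TorusSite 2 L → ℝ → TorusSite 2 L → ℂ)
    (hAdef : A = fun j Qm t => Matrix.of fun k k' : TorusSite 2 L => if k ∈ klBall L μ 0 ∧ k' ∈ klBall L μ 0 then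
      vertexFn L M β (gaussConv ℂ
        (softCovOf L M β μ (klFlowFrameU L M β U μ (n + 1)) (softSymbolCompl L M β μ (klFlowFrameU L M β U μ (n + 1)) (n + 1) j) + hubbardCovAboveCT L M β μ 0 (klFlowFrameU L M β U μ (n + 1)) (klScale klE0 (n + 1)) -
          hubbardCovAboveCT L M β μ 0 (klFlowFrameU L M β U μ (n + 1)) (klScale klE0 n + t * (klScale klE0 (n + 1) - klScale klE0 n)))
        (hubbardEffectiveActionCT L M β U μ 0 (klFlowFrameU L M β U μ (n + 1)) (klScale klE0 n + t * (klScale klE0 (n + 1) - klScale klE0 n)))) 4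
        ![(((omega0 M, k'), 0), 0), ((((omega0 M).rev, Qm - k'), 1), 0), ((((omega0 M).rev, Qm - k), 1), 1), (((omega0 M, k), 0), 1)]
      else 0)
    (hA'def : A' = fun j Qm t => Matrix.of fun k k' : TorusSite 2 L => if k ∈ klBall L μ 0 ∧ k' ∈ klBall L μ 0 then
      (klScale klE0 (n + 1) - klScale klE0 n) • -((2 : ℂ)⁻¹ * vertexFn L M β (gaussConv ℂ
        (softCovOf L M β μ (klFlowFrameU L M β U μ (n + 1)) (softSymbolCompl L M β μ (klFlowFrameU L M β U μ (n + 1)) (n + 1) j) + hubbardCovAboveCT L M β μ 0 (klFlowFrameU L M β U μ (n + 1)) (klScale klE0 (n + 1)) -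
          hubbardCovAboveCT L M β μ 0 (klFlowFrameU L M β U μ (n + 1)) (klScale klE0 n + t * (klScale klE0 (n + 1) - klScale klE0 n)))
        (grassmannDerivPairing ℂ
          (Matrix.of fun X Y : HubbardFieldIdx L M => deriv (fun Λ'' : ℝ => hubbardCovAboveCT L M β μ 0 (klFlowFrameU L M β U μ (n + 1)) Λ'' X Y)
            (klScale klE0 n + t * (klScale klE0 (n + 1) - klScale klE0 n)))
          (hubbardEffectiveActionCT L M β U μ 0 (klFlowFrameU L M β U μ (n + 1)) (klScale klE0 n + t * (klScale klE0 (n + 1) - klScale klE0 n)))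
          (hubbardEffectiveActionCT L M β U μ 0 (klFlowFrameU L M β U μ (n + 1)) (klScale klE0 n + t * (klScale klE0 (n + 1) - klScale klE0 n))))) 4
        ![(((omega0 M, k'), 0), 0), ((((omega0 M).rev, Qm - k'), 1), 0), ((((omega0 M).rev, Qm - k), 1), 1), (((omega0 M, k), 0), 1)])
      else 0)
    (hbdef : b = fun j Qm t p => -((klBubbleMass L M β μ (klFlowFrameU L M β U μ (n + 1))
        (fun k => (softSymbolCompl L M β μ (klFlowFrameU L M β U μ (n + 1)) (n + 1) j) k + (hubbardCutoffWeightCT L M β μ (klFlowFrameU L M β U μ (n + 1)) (klScale klE0 (n + 1)) k -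
          hubbardCutoffWeightCT L M β μ (klFlowFrameU L M β U μ (n + 1)) (klScale klE0 n + t * (klScale klE0 (n + 1) - klScale klE0 n)) k))
        (fun k => (softSymbolCompl L M β μ (klFlowFrameU L M β U μ (n + 1)) (n + 1) j) k + (hubbardCutoffWeightCT L M β μ (klFlowFrameU L M β U μ (n + 1)) (klScale klE0 (n + 1)) k -
          hubbardCutoffWeightCT L M β μ (klFlowFrameU L M β U μ (n + 1)) (klScale klE0 n + t * (klScale klE0 (n + 1) - klScale klE0 n)) k)) Qm p : ℝ) : ℂ))
    (hb'def : b' = fun j Qm t p => (((klScale klE0 (n + 1) - klScale klE0 n) *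
        (klBubbleMass L M β μ (klFlowFrameU L M β U μ (n + 1))
            (fun k => deriv (fun Λ' => hubbardCutoffWeightCT L M β μ (klFlowFrameU L M β U μ (n + 1)) Λ' k) (klScale klE0 n + t * (klScale klE0 (n + 1) - klScale klE0 n)))
            (fun k => (softSymbolCompl L M β μ (klFlowFrameU L M β U μ (n + 1)) (n + 1) j) k + (hubbardCutoffWeightCT L M β μ (klFlowFrameU L M β U μ (n + 1)) (klScale klE0 (n + 1)) k -
          hubbardCutoffWeightCT L M β μ (klFlowFrameU L M β U μ (n + 1)) (klScale klE0 n + t * (klScale klE0 (n + 1) - klScale klE0 n)) k)) Qm p +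
          klBubbleMass L M β μ (klFlowFrameU L M β U μ (n + 1))
            (fun k => (softSymbolCompl L M β μ (klFlowFrameU L M β U μ (n + 1)) (n + 1) j) k + (hubbardCutoffWeightCT L M β μ (klFlowFrameU L M β U μ (n + 1)) (klScale klE0 (n + 1)) k -
          hubbardCutoffWeightCT L M β μ (klFlowFrameU L M β U μ (n + 1)) (klScale klE0 n + t * (klScale klE0 (n + 1) - klScale klE0 n)) k))
            (fun k => deriv (fun Λ' => hubbardCutoffWeightCT L M β μ (klFlowFrameU L M β U μ (n + 1)) Λ' k) (klScale klE0 n + t * (klScale klE0 (n + 1) - klScale klE0 n)))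
            Qm p) : ℝ) : ℂ))
    (hadef : a = fun j j' Qm t p => (b j Qm t p - b j' Qm t p) +
      (-(((klTransferWeight L M β μ (klFlowFrameU L M β U μ (n + 1)) (n + 1) (softSymbolCompl L M β μ (klFlowFrameU L M β U μ (n + 1)) (n + 1) j) Qm p -
          klTransferWeight L M β μ (klFlowFrameU L M β U μ (n + 1)) (n + 1) (softSymbolCompl L M β μ (klFlowFrameU L M β U μ (n + 1)) (n + 1) j') Qm p : ℝ)) : ℂ) -
        (b j Qm 1 p - b j' Qm 1 p)))
    (ρ : ℕ → TorusSite 2 L → TorusSite 2 L → ℝ)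
    (hρdef : ρ = fun j Qm c => klRungProfile L M β μ (klFlowFrameU L M β U μ (n + 1)) n (softSymbolCompl L M β μ (klFlowFrameU L M β U μ (n + 1)) (n + 1) j) Qm c)
    (ah : ℕ → ℕ → TorusSite 2 L → TorusSite 2 L → ℂ)
    (hahdef : ah = fun j j' Qm c => -(((klTransferWeight L M β μ (klFlowFrameU L M β U μ n) n (softSymbolCompl L M β μ (klFlowFrameU L M β U μ n) n j) Qm c -
            klTransferWeight L M β μ (klFlowFrameU L M β U μ n) n (softSymbolCompl L M β μ (klFlowFrameU L M β U μ n) n j') Qm c : ℝ)) : ℂ))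
    (hhist : ∀ j j' : ℕ, n ≤ j' → j' ≤ j → j ≤ nScales β + 1 → ∀ Qm : TorusSite 2 L, IsPairClassAt L Qm n →
      ∀ k ∈ klBall L μ 0, ∀ k' ∈ klBall L μ 0,
      ‖(klMemberArrayF L M β U μ n (softSymbolCompl L M β μ (klFlowFrameU L M β U μ n) n j) Qm + klMemberArrayF L M β U μ n (softSymbolCompl L M β μ (klFlowFrameU L M β U μ n) n j) Qm *
          diagonal (fun c => -(((klTransferWeight L M β μ (klFlowFrameU L M β U μ n) n (softSymbolCompl L M β μ (klFlowFrameU L M β U μ n) n j) Qm c -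
            klTransferWeight L M β μ (klFlowFrameU L M β U μ n) n (softSymbolCompl L M β μ (klFlowFrameU L M β U μ n) n j') Qm c : ℝ)) : ℂ)) * klMemberArrayF L M β U μ n (softSymbolCompl L M β μ (klFlowFrameU L M β U μ n) n j') Qm -
          klMemberArrayF L M β U μ n (softSymbolCompl L M β μ (klFlowFrameU L M β U μ n) n j') Qm) k k'‖ ≤ θ * transferBarRelIdx L G P r β U n j' Qm k k')
    (hdata : ∀ j j' : ℕ, n + 1 ≤ j' → j' ≤ j → j ≤ nScales β + 1 → ∀ Qm : TorusSite 2 L, IsPairClassAt L Qm (n + 1) →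
      ∃ (ηr η₁ η₂ R₀ I Ran : TorusSite 2 L → TorusSite 2 L → ℝ) (d : TorusSite 2 L → ℝ) (δ₀ ξ ξ₁ ξ₂ : ℝ),
        0 ≤ ξ ∧ 0 ≤ ξ₁ ∧ 0 ≤ ξ₂ ∧
        -- ANALYTIC: a priori size of the two member arrays along the slice; the two Riccati-defect sups
        (∀ t ∈ Icc (0 : ℝ) 1, ∀ x y, ‖A j Qm t x y‖ ≤ mA) ∧ (∀ t ∈ Icc (0 : ℝ) 1, ∀ x y, ‖A j' Qm t x y‖ ≤ mA) ∧
        (∀ t ∈ Icc (0 : ℝ) 1, ∀ x y, ‖(A' j Qm t + A j Qm t * diagonal (b' j Qm t) * A j Qm t) x y‖ ≤ ξ₁) ∧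
        (∀ t ∈ Icc (0 : ℝ) 1, ∀ x y, ‖(A' j' Qm t + A j' Qm t * diagonal (b' j' Qm t) * A j' Qm t) x y‖ ≤ ξ₂) ∧
        -- the history array's a priori size; the START RE-FRAME majorants ((F)(i) lane) against the history objects at frame `K_n`, and their sup `δ₀`
        (∀ x y, ‖klMemberArrayF L M β U μ n (softSymbolCompl L M β μ (klFlowFrameU L M β U μ n) n j) Qm x y‖ ≤ mA) ∧
        (∀ x y, ‖((A j Qm 0 - klMemberArrayF L M β U μ n (softSymbolCompl L M β μ (klFlowFrameU L M β U μ n) n j) Qm) - (A j' Qm 0 - klMemberArrayF L M β U μ n (softSymbolCompl L M β μ (klFlowFrameU L M β U μ n) n j') Qm)) x y‖ ≤ ηr x y) ∧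
        (∀ x y, ‖(A j Qm 0 - klMemberArrayF L M β U μ n (softSymbolCompl L M β μ (klFlowFrameU L M β U μ n) n j) Qm) x y‖ ≤ η₁ x y) ∧
        (∀ x y, ‖(A j' Qm 0 - klMemberArrayF L M β U μ n (softSymbolCompl L M β μ (klFlowFrameU L M β U μ n) n j') Qm) x y‖ ≤ η₂ x y) ∧
        (∀ c, ‖a j j' Qm 0 c - ah j j' Qm c‖ ≤ d c) ∧
        (∀ x y, (ηr x y + mA * ∑ c, η₁ x c * (d c + ‖ah j j' Qm c‖) + mA * mA * ∑ c, d c + mA * ∑ c, ‖ah j j' Qm c‖ * η₂ c y) ≤ R₀ x y) ∧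
        (∀ x y, R₀ x y ≤ δ₀) ∧
        -- ANALYTIC: the relative Riccati defect along the slice (sup and time integral)
        (∀ t ∈ Icc (0 : ℝ) 1, ∀ x y, ‖(((A' j Qm t + A j Qm t * diagonal (b' j Qm t) * A j Qm t) * (1 + diagonal (a j j' Qm t) * A j' Qm t) +
            A j Qm t * diagonal (a j j' Qm t) * (A' j' Qm t + A j' Qm t * diagonal (b' j' Qm t) * A j' Qm t) - (A' j' Qm t + A j' Qm t * diagonal (b' j' Qm t) * A j' Qm t))) x y‖ ≤ ξ) ∧
        (∀ x y, (∫ t in (0 : ℝ)..1, ‖(((A' j Qm t + A j Qm t * diagonal (b' j Qm t) * A j Qm t) * (1 + diagonal (a j j' Qm t) * A j' Qm t) +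
            A j Qm t * diagonal (a j j' Qm t) * (A' j' Qm t + A j' Qm t * diagonal (b' j' Qm t) * A j' Qm t) - (A' j' Qm t + A j' Qm t * diagonal (b' j' Qm t) * A j' Qm t))) x y‖) ≤ I x y) ∧
        -- the ANALYTIC majorant `Ran` (re-frame part + relative-defect part dressed by the rung profiles + the transport constant)
        (∀ x y, R₀ x y +
            (I x y + ∑ c, I x c * ρ j' Qm c * mA + ∑ a', mA * ρ j Qm a' * I a' y + ∑ a', ∑ c, mA * ρ j Qm a' * I a' c * ρ j' Qm c * mA) +
            4 / 3 * ((θ * (klIdxPrefactor r n * ((P.Klam * U) ^ 2 * ((2 * ((n : ℝ) + 2) + ((2 : ℝ) ^ n)⁻¹ + ((L : ℝ))⁻¹) * klIdxMass n j' + ((4 : ℝ) ^ n)⁻¹ * klIdxOverlap n j') +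
              ((P.Klam * |U|) ^ 3 * ((2 : ℝ) ^ n)⁻¹ + thermalBar G P U β n) * klIdxMass n j')) + δ₀) * Real.exp (mA * ((2 : ℝ) ^ 10 * 15367) + mA * ((2 : ℝ) ^ 10 * 15367)) + 2 * ξ) * ((2 : ℝ) ^ 10 * 15367) * (8 / 3 * ξ₁ + 8 / 3 * ξ₂) ≤ Ran x y) ∧
        -- FLAT budget: a `k`-free sup of `Ran` against half the `k`-free floor of the slice's ROOM
        ∃ Rs : ℝ, (∀ x y, Ran x y ≤ Rs) ∧ 2 * Rs ≤ θ * (klIdxPrefactor r (n + 1) * ((P.Klam * U) ^ 2 * ((((2 : ℝ) ^ n)⁻¹ + 3 * ((L : ℝ))⁻¹) * klIdxMass n j' + ((4 : ℝ) ^ (n + 1))⁻¹ * klIdxOverlap (n + 1) j') +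
            ((P.Klam * |U|) ^ 3 * ((2 : ℝ) ^ n)⁻¹ + 3 * thermalBar G P U β (n + 1)) * klIdxMass n j'))) :
    ∀ j j' : ℕ, n + 1 ≤ j' → j' ≤ j → j ≤ nScales β + 1 → ∀ Qm : TorusSite 2 L, IsPairClassAt L Qm (n + 1) →
      ∀ k ∈ klBall L μ 0, ∀ k' ∈ klBall L μ 0,
      ‖(klMemberArrayF L M β U μ (n + 1) (softSymbolCompl L M β μ (klFlowFrameU L M β U μ (n + 1)) (n + 1) j) Qm + klMemberArrayF L M β U μ (n + 1) (softSymbolCompl L M β μ (klFlowFrameU L M β U μ (n + 1)) (n + 1) j) Qm *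
          diagonal (fun p => -(((klTransferWeight L M β μ (klFlowFrameU L M β U μ (n + 1)) (n + 1) (softSymbolCompl L M β μ (klFlowFrameU L M β U μ (n + 1)) (n + 1) j) Qm p -
            klTransferWeight L M β μ (klFlowFrameU L M β U μ (n + 1)) (n + 1) (softSymbolCompl L M β μ (klFlowFrameU L M β U μ (n + 1)) (n + 1) j') Qm p : ℝ)) : ℂ)) * klMemberArrayF L M β U μ (n + 1) (softSymbolCompl L M β μ (klFlowFrameU L M β U μ (n + 1)) (n + 1) j') Qm -
          klMemberArrayF L M β U μ (n + 1) (softSymbolCompl L M β μ (klFlowFrameU L M β U μ (n + 1)) (n + 1) j') Qm) k k'‖ ≤ θ * transferBarRelIdx L G P r β U (n + 1) j' Qm k k' := by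
  refine pairTransferRelResIdx_family_succ_of_analytic L M hCF hKl hr hm hθ0 hKf hβ hβL hη₀ hnum hZ A A' b b' a hAdef hA'def hbdef hb'def hadef
    ρ hρdef ah hahdef hhist ?_
  intro j j' h1 h2 h3 Qm hQm
  obtain ⟨ηr, η₁, η₂, R₀, I, Ran, d, δ₀, ξ, ξ₁, ξ₂, hξ, hξ₁, hξ₂, hA₁, hA₂, hS₁, hS₂, hH, hηr, hη₁, hη₂, hd, hR₀, hδ₀, hXξ, hI, hRan,
    Rs, hRs, hbud⟩ := hdata j j' h1 h2 h3 Qm hQm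
  refine ⟨ηr, η₁, η₂, R₀, I, Ran, d, δ₀, ξ, ξ₁, ξ₂, hξ, hξ₁, hξ₂, hA₁, hA₂, hS₁, hS₂, hH, hηr, hη₁, hη₂, hd, hR₀, hδ₀, hXξ, hI, hRan, ?_⟩
  intro k hk k' hk'
  -- numerics and the profile masses
  have h15 : ((2 : ℝ) ^ 10 * 15367) = 15735808 := by norm_num
  have hnum' : mA * 15735808 ≤ 1 / 3 := by rw [h15] at hnum; exact hnum
  have hstep : 3 / 2 * mA * 738288 ≤ 1 / 32 := by nlinarith
  have hβ0 : 0 < β := pos_of_klBetaMin_le hβ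
  have hj1 : n + 1 ≤ j := h1.trans h2
  have hρ0 : ∀ i c, 0 ≤ ρ i Qm c := fun i c => by
    rw [hρdef]; exact klRungProfile_nonneg β μ _ hβ0 n _ Qm c
  have hZρ : ∀ i, n + 1 ≤ i → ∑ c, ρ i Qm c ≤ 738288 := fun i hi => by
    rw [hρdef]; exact sum_klRungProfile_compl_le β μ _ hKf hβ hβL hi Qm
  have hm' : (0 : ℝ) ≤ 3 / 2 * mA := by positivity
  have hσ₁ : 3 / 2 * mA * ∑ a', ρ j Qm a' ≤ 1 / 32 := by
    have := mul_le_mul_of_nonneg_left (hZρ j hj1) hm'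
    linarith
  have hσ₂ : 3 / 2 * mA * ∑ c, ρ j' Qm c ≤ 1 / 32 := by
    have := mul_le_mul_of_nonneg_left (hZρ j' h1) hm'
    linarith
  -- `0 ≤ Rs` (every row of `Ran` is a majorant of nonnegative quantities)
  have hflat0 : 0 ≤ (klIdxPrefactor r n * ((P.Klam * U) ^ 2 * ((2 * ((n : ℝ) + 2) + ((2 : ℝ) ^ n)⁻¹ + ((L : ℝ))⁻¹) * klIdxMass n j' + ((4 : ℝ) ^ n)⁻¹ * klIdxOverlap n j') +
              ((P.Klam * |U|) ^ 3 * ((2 : ℝ) ^ n)⁻¹ + thermalBar G P U β n) * klIdxMass n j')) :=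
    (transferBarRelIdx_nonneg hCF hKl hr β U n j' Qm Qm Qm).trans (transferBarRelIdx_le_flat (G := G) (P := P) hr β U n j' Qm Qm Qm)
  have hηr0 : ∀ x y, 0 ≤ ηr x y := fun x y => (norm_nonneg _).trans (hηr x y)
  have hη₁0 : ∀ x c, 0 ≤ η₁ x c := fun x c => (norm_nonneg _).trans (hη₁ x c)
  have hη₂0 : ∀ c y, 0 ≤ η₂ c y := fun c y => (norm_nonneg _).trans (hη₂ c y)
  have hd0 : ∀ c, 0 ≤ d c := fun c => (norm_nonneg _).trans (hd c)
  have hI0 : ∀ x y, 0 ≤ I x y := fun x y =>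
    le_trans (intervalIntegral.integral_nonneg zero_le_one fun t _ => norm_nonneg _) (hI x y)
  have hR00 : ∀ x y, 0 ≤ R₀ x y := fun x y => by
    have h := hR₀ x y
    have s1 : 0 ≤ ∑ c, η₁ x c * (d c + ‖ah j j' Qm c‖) := Finset.sum_nonneg fun c _ => mul_nonneg (hη₁0 x c) (add_nonneg (hd0 c) (norm_nonneg _))
    have s2 : 0 ≤ ∑ c, d c := Finset.sum_nonneg fun c _ => hd0 c
    have s3 : 0 ≤ ∑ c, ‖ah j j' Qm c‖ * η₂ c y := Finset.sum_nonneg fun c _ => mul_nonneg (norm_nonneg _) (hη₂0 c y)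
    have := hηr0 x y
    have := mul_nonneg hm s1
    have := mul_nonneg (mul_nonneg hm hm) s2
    have := mul_nonneg hm s3
    linarith
  have hδ00 : 0 ≤ δ₀ := (hR00 k k).trans (hδ₀ k k)
  have hRan0 : 0 ≤ Ran k k := by
    have h := hRan k k
    have i1 : 0 ≤ ∑ c, I k c * ρ j' Qm c * mA := Finset.sum_nonneg fun c _ => mul_nonneg (mul_nonneg (hI0 k c) (hρ0 j' c)) hm
    have i2 : 0 ≤ ∑ a', mA * ρ j Qm a' * I a' k := Finset.sum_nonneg fun a' _ => mul_nonneg (mul_nonneg hm (hρ0 j a')) (hI0 a' k)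
    have i3 : 0 ≤ ∑ a', ∑ c, mA * ρ j Qm a' * I a' c * ρ j' Qm c * mA := Finset.sum_nonneg fun a' _ => Finset.sum_nonneg fun c _ =>
      mul_nonneg (mul_nonneg (mul_nonneg (mul_nonneg hm (hρ0 j a')) (hI0 a' c)) (hρ0 j' c)) hm
    have i4 : 0 ≤ 4 / 3 * ((θ * (klIdxPrefactor r n * ((P.Klam * U) ^ 2 * ((2 * ((n : ℝ) + 2) + ((2 : ℝ) ^ n)⁻¹ + ((L : ℝ))⁻¹) * klIdxMass n j' + ((4 : ℝ) ^ n)⁻¹ * klIdxOverlap n j') +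
              ((P.Klam * |U|) ^ 3 * ((2 : ℝ) ^ n)⁻¹ + thermalBar G P U β n) * klIdxMass n j')) + δ₀) * Real.exp (mA * ((2 : ℝ) ^ 10 * 15367) + mA * ((2 : ℝ) ^ 10 * 15367)) + 2 * ξ) *
        ((2 : ℝ) ^ 10 * 15367) * (8 / 3 * ξ₁ + 8 / 3 * ξ₂) := by
      have : 0 ≤ θ * (klIdxPrefactor r n * ((P.Klam * U) ^ 2 * ((2 * ((n : ℝ) + 2) + ((2 : ℝ) ^ n)⁻¹ + ((L : ℝ))⁻¹) * klIdxMass n j' + ((4 : ℝ) ^ n)⁻¹ * klIdxOverlap n j') +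
              ((P.Klam * |U|) ^ 3 * ((2 : ℝ) ^ n)⁻¹ + thermalBar G P U β n) * klIdxMass n j')) + δ₀ := add_nonneg (mul_nonneg hθ0 hflat0) hδ00
      positivity
    have := hR00 k k
    have := hI0 k k
    linarith
  have hRs0 : 0 ≤ Rs := hRan0.trans (hRs k k)
  -- the flat four-term bound and the room comparison
  have hFT := kltc_fourTerm_le_of_le_const hm (fun a' => hρ0 j a') (fun c => hρ0 j' c) hσ₁ hσ₂ Ran hRs0 hRs k k'
  rw [show ((1 : ℝ) + 1 / 32) ^ 2 = 1089 / 1024 by norm_num] at hFT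
  have hg1 : 0 ≤ min (klTorusNorm L (k - k') / klScale klE0 (n + 1)) (klScale klE0 (n + 1) / klTorusNorm L (k - k')) :=
    le_min (div_nonneg (torusSupNorm_nonneg _) (klth_klScale_pos _).le) (div_nonneg (klth_klScale_pos _).le (torusSupNorm_nonneg _))
  have hg2 : 0 ≤ min (klTorusNorm L (k + k' - Qm) / klScale klE0 (n + 1)) (klScale klE0 (n + 1) / klTorusNorm L (k + k' - Qm)) :=
    le_min (div_nonneg (torusSupNorm_nonneg _) (klth_klScale_pos _).le) (div_nonneg (klth_klScale_pos _).le (torusSupNorm_nonneg _))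
  have hpre := klIdxPrefactor_nonneg hr (n + 1)
  have hms := klIdxMass_nonneg n j'
  have hK2 : 0 ≤ (P.Klam * U) ^ 2 := by positivity
  have hcmp : (klIdxPrefactor r (n + 1) * ((P.Klam * U) ^ 2 * ((((2 : ℝ) ^ n)⁻¹ + 3 * ((L : ℝ))⁻¹) * klIdxMass n j' + ((4 : ℝ) ^ (n + 1))⁻¹ * klIdxOverlap (n + 1) j') +
            ((P.Klam * |U|) ^ 3 * ((2 : ℝ) ^ n)⁻¹ + 3 * thermalBar G P U β (n + 1)) * klIdxMass n j')) ≤ (klIdxPrefactor r (n + 1) * ((P.Klam * U) ^ 2 *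
              ((min (klTorusNorm L (k - k') / klScale klE0 (n + 1)) (klScale klE0 (n + 1) / klTorusNorm L (k - k')) +
                  min (klTorusNorm L (k + k' - Qm) / klScale klE0 (n + 1)) (klScale klE0 (n + 1) / klTorusNorm L (k + k' - Qm)) +
                  ((2 : ℝ) ^ n)⁻¹ + 3 * ((L : ℝ))⁻¹) * klIdxMass n j' + ((4 : ℝ) ^ (n + 1))⁻¹ * klIdxOverlap (n + 1) j') +
            ((P.Klam * |U|) ^ 3 * ((2 : ℝ) ^ n)⁻¹ + 3 * thermalBar G P U β (n + 1)) * klIdxMass n j')) := by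
    have hx : 0 ≤ klIdxPrefactor r (n + 1) * ((P.Klam * U) ^ 2 *
        ((min (klTorusNorm L (k - k') / klScale klE0 (n + 1)) (klScale klE0 (n + 1) / klTorusNorm L (k - k')) +
          min (klTorusNorm L (k + k' - Qm) / klScale klE0 (n + 1)) (klScale klE0 (n + 1) / klTorusNorm L (k + k' - Qm))) * klIdxMass n j')) :=
      mul_nonneg hpre (mul_nonneg hK2 (mul_nonneg (add_nonneg hg1 hg2) hms))
    nlinarith [hx]
  have hθcmp := mul_le_mul_of_nonneg_left hcmp hθ0
  have hTbk : 0 ≤ θ * (((2 : ℝ) ^ (n + 2))⁻¹ * transferBarRelIdx L G P r β U n j' Qm k k') :=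
    mul_nonneg hθ0 (mul_nonneg (by positivity) (transferBarRelIdx_nonneg hCF hKl hr β U n j' Qm k k'))
  -- atomize and conclude
  obtain ⟨Rf, hRf⟩ : ∃ Rf : ℝ, Rf = (klIdxPrefactor r (n + 1) * ((P.Klam * U) ^ 2 * ((((2 : ℝ) ^ n)⁻¹ + 3 * ((L : ℝ))⁻¹) * klIdxMass n j' + ((4 : ℝ) ^ (n + 1))⁻¹ * klIdxOverlap (n + 1) j') +
            ((P.Klam * |U|) ^ 3 * ((2 : ℝ) ^ n)⁻¹ + 3 * thermalBar G P U β (n + 1)) * klIdxMass n j')) := ⟨_, rfl⟩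
  obtain ⟨Rm, hRm⟩ : ∃ Rm : ℝ, Rm = (klIdxPrefactor r (n + 1) * ((P.Klam * U) ^ 2 *
              ((min (klTorusNorm L (k - k') / klScale klE0 (n + 1)) (klScale klE0 (n + 1) / klTorusNorm L (k - k')) +
                  min (klTorusNorm L (k + k' - Qm) / klScale klE0 (n + 1)) (klScale klE0 (n + 1) / klTorusNorm L (k + k' - Qm)) +
                  ((2 : ℝ) ^ n)⁻¹ + 3 * ((L : ℝ))⁻¹) * klIdxMass n j' + ((4 : ℝ) ^ (n + 1))⁻¹ * klIdxOverlap (n + 1) j') +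
            ((P.Klam * |U|) ^ 3 * ((2 : ℝ) ^ n)⁻¹ + 3 * thermalBar G P U β (n + 1)) * klIdxMass n j')) := ⟨_, rfl⟩
  rw [← hRf] at hbud hθcmp
  rw [← hRm] at hθcmp ⊢
  nlinarith [hFT, hbud, hθcmp, hTbk]

end Analytic

end Summit.HubbardSuperconductivity.HubbardSuperconductivity.Theorems.KLRegimeSplit

end
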